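import Literature.AnabelianGeometry.EtaleTheta.DoubleUnderlineOfCocycle
import Literature.AnabelianGeometry.EtaleTheta.BarDeltaOfSetting

/-!
# B14 «PlusMinusTower.ofCoverModel», PRELIMINARY (geometric normality): `Δ^tp_{X̲̲_v} ⊴ Δ^tp_{X̲_v}` for abc-iut-L2-t7's
# cocycle-constructed `X̲̲` (proof-only)

S. Mochizuki, *Inter-universal Teichmüller theory II*, kurims manuscript (Dec. 2020), §2, Def. 2.3 (i) p. 67: "we recall that `Δ̂_v`
includes as a normal open subgroup of `Δ̂^±_v` of index `l` [cf. [EtTh], Proposition 2.2, (ii); [EtTh], Remark 2.6.1]"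
([IUTchII] Def 2.3 (i), kurims p.67) [claim: Mochizuki2012, status: disputed] (D-0012 claim key; series status DISPUTED — elementary group
theory over abc-iut-L2's [EtTh] data only; nothing of the series is asserted); [EtTh] Prop. 2.2 (ii) p. 37, Def. 2.7 p. 41, and §1
p. 12 ("`Δ^Θ_X` … `Δ_Θ ≅ Ẑ(1)` [central]") [cite: MochizukiEtTh2009, Prop 2.2 (ii) p.37].  PROOF-ONLY file (abc-iut cell, seat
abc-iut-L6-t19 gen 5, HOLDER-DESIGNATE of MERGE-MAP row B14, abc-iut-L6-lead §F v1.19e (3)); no definitions; decls added to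
abc-iut-L2's namespaces BY NAME over their theorems.

THE INPUT `deltaHat_normal` OF `PlusMinusTower` ("`Δ̂_v ⊴ Δ̂^±_v`"), tempered level, at the model where `X̲̲` is abc-iut-L2-t7's
COCYCLE construction (`XuuCocycleData.Huu = Π^tp_X̲̲ := {g ∈ Π^tp_X̲ | F̄(g) = 1}`, `F̄ : Π^tp_X̲ → Δ_Θ/l·Δ_Θ` the mod-`l·Δ_Θ` cocycle of
[EtTh] Def. 2.7): the conjugation action of a GEOMETRIC element `δ ∈ Δ^tp_X` on `Δ_Θ/l·Δ_Θ` is trivial, because `Δ_Θ` is CENTRAL in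
`(Δ^tp_X)^Θ` (abc-iut-L2-d3's `ThetaSetting.deltaTheta_comm_dtpTheta`, the class-two structure of `Δ^Θ_X`, [EtTh] p. 12); hence `F̄`
restricted to `Δ^tp_X ∩ Π^tp_X̲` is a HOMOMORPHISM, and its kernel `Δ^tp_X ∩ Π^tp_X̲̲` is normal in `Δ^tp_X ∩ Π^tp_X̲`:

* `XuuCocycleData.actBar_toTheta_eq_self_of_mem_deltaTemp` — `δ ∈ Δ^tp_X` acts trivially on `Δ_Θ/l·Δ_Θ`;
* `XuuCocycleData.Fbar_mul_of_mem_deltaTemp` — `F̄(gh) = F̄(g)·F̄(h)` for `g` geometric;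
* `XuuCocycleData.conj_mem_Huu0_of_mem_deltaTemp` — `k n k⁻¹ ∈ Π^tp_X̲̲` for geometric `k ∈ Π^tp_X̲`, `n ∈ Π^tp_X̲̲ ∩ Δ^tp_X`;
* **`XuuCocycleData.huu_inf_deltaTemp_subgroupOf_normal`** — `(Π^tp_X̲̲ ∩ Δ^tp_X) ⊴ (Π^tp_X̲ ∩ Δ^tp_X)`, i.e. `Δ^tp_{X̲̲} ⊴ Δ^tp_{X̲}`;
  `XuuCocycleData.doubleUnderline_huu_inf_deltaTemp_subgroupOf_normal` — the same for the assembled `Ξ.doubleUnderline : E.DoubleUnderline l`.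

NOT here (honest scope): ARITHMETIC normality `Π^tp_X̲̲ ⊴ Π^tp_X̲` (needs "`Π^tp_X̲` acts trivially on `Δ_Θ/l·Δ_Θ`", i.e. `μ_l ⊆ K` read
through a level-`l` cyclotome identification — asked of the abc-iut-L2-t8 lineage 03:48Z); normality for an ABSTRACT
`EtaleThetaData.DoubleUnderline` (not derivable from its fields).  Nothing here takes a side on [IUTchIII] Cor. 3.12; typed ≠ proved.
-/

noncomputable section

namespace Literature.AnabelianGeometry.EtaleTheta

namespace ThetaSetting

namespace EtaleThetaData

namespace XuuCocycleData

variable {p : ℕ} [Fact p.Prime] {D : ThetaSetting p} {E : D.EtaleThetaData} {l : ℕ} (Ξ : XuuCocycleData E l)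

/-- **A geometric element acts trivially on `Δ_Θ/l·Δ_Θ`**: for `δ ∈ Δ^tp_X`, conjugation by `θ(δ) ∈ (Δ^tp_X)^Θ` fixes `Δ_Θ` pointwise
(`Δ_Θ` central in `(Δ^tp_X)^Θ`, abc-iut-L2-d3's `deltaTheta_comm_dtpTheta`), so `actBar (θ δ) = id`.  PROVED.
[cite: MochizukiEtTh2009, §1 p.12] -/
theorem actBar_toTheta_eq_self_of_mem_deltaTemp {δ : D.PiTemp} (hδ : δ ∈ D.DeltaTemp) (u : DeltaThetaModL D l) :
    actBar D l (D.toTheta δ) u = u := by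
  induction u using QuotientGroup.induction_on with
  | H a =>
    rw [actBar_mk]
    congr 1
    apply Subtype.ext
    rw [MulAut.conjNormal_apply]
    have hcomm := D.deltaTheta_comm_dtpTheta a.2 (⟨δ, hδ, rfl⟩ : D.toTheta δ ∈ D.DtpTheta)
    -- `θδ · a · (θδ)⁻¹ = a` from `a · θδ = θδ · a`
    rw [← hcomm, mul_inv_cancel_right]

/-- **`F̄` is multiplicative on products with a geometric left factor**: `F̄(gh) = F̄(g)·F̄(h)` for `g ∈ Π^tp_X̲ ∩ Δ^tp_X` (the cocycle
identity `F̄(gh) = F̄(g)·θ(g)F̄(h)θ(g)⁻¹` with trivial action).  PROVED. [cite: MochizukiEtTh2009, Def 2.7 p.41] -/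
theorem Fbar_mul_of_mem_deltaTemp (g h : ↥(D.GtpXu l)) (hg : (g : D.PiTemp) ∈ D.DeltaTemp) :
    Ξ.Fbar (g * h) = Ξ.Fbar g * Ξ.Fbar h := by
  rw [Ξ.Fbar_mul, actBar_toTheta_eq_self_of_mem_deltaTemp hg]

/-- For geometric `k ∈ Π^tp_X̲ ∩ Δ^tp_X`: `F̄(k)·F̄(k⁻¹) = 1`. [cite: MochizukiEtTh2009, Def 2.7 p.41] -/
theorem Fbar_mul_Fbar_inv_of_mem_deltaTemp (k : ↥(D.GtpXu l)) (hk : (k : D.PiTemp) ∈ D.DeltaTemp) :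
    Ξ.Fbar k * Ξ.Fbar k⁻¹ = 1 := by
  rw [← Ξ.Fbar_mul_of_mem_deltaTemp k k⁻¹ hk, mul_inv_cancel, Ξ.Fbar_one]

/-- **Conjugating within the geometric part preserves `Π^tp_X̲̲`**: for `k ∈ Π^tp_X̲ ∩ Δ^tp_X` and `n ∈ Π^tp_X̲̲ ∩ Δ^tp_X` (both geometric),
`k n k⁻¹ ∈ Π^tp_X̲̲` — `F̄(knk⁻¹) = F̄(k)·F̄(n)·F̄(k⁻¹) = F̄(k)·F̄(k⁻¹) = 1`.  PROVED. [cite: MochizukiEtTh2009, Prop 2.2 (ii) p.37] -/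
theorem conj_mem_Huu0_of_mem_deltaTemp {k n : ↥(D.GtpXu l)} (hk : (k : D.PiTemp) ∈ D.DeltaTemp)
    (hn : (n : D.PiTemp) ∈ D.DeltaTemp) (hn0 : n ∈ Ξ.Huu0) : k * n * k⁻¹ ∈ Ξ.Huu0 := by
  have hn1 : Ξ.Fbar n = 1 := hn0
  have hkn : ((k * n : ↥(D.GtpXu l)) : D.PiTemp) ∈ D.DeltaTemp := D.DeltaTemp.mul_mem hk hn
  change Ξ.Fbar (k * n * k⁻¹) = 1
  rw [Ξ.Fbar_mul_of_mem_deltaTemp (k * n) k⁻¹ hkn, Ξ.Fbar_mul_of_mem_deltaTemp k n hk, hn1, mul_one,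
    Ξ.Fbar_mul_Fbar_inv_of_mem_deltaTemp k hk]

/-- **`Δ^tp_{X̲̲_v} ⊴ Δ^tp_{X̲_v}` for the cocycle-constructed `X̲̲`** — print's "`Δ̂_v` … normal … subgroup of `Δ̂^±_v`" ([IUTchII] Def. 2.3 (i);
[EtTh] Prop. 2.2 (ii)) at the tempered level of the model: `(Π^tp_X̲̲ ∩ Δ^tp_X)` is a normal subgroup of `(Π^tp_X̲ ∩ Δ^tp_X)`.  The
input `deltaHat_normal` of abc-iut-L6-t1's `PlusMinusTower`, before completion.  PROVED. ([IUTchII] Def 2.3 (i), kurims p.67) [claim: Mochizuki2012, status: disputed] -/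
theorem huu_inf_deltaTemp_subgroupOf_normal :
    ((Ξ.Huu ⊓ D.DeltaTemp).subgroupOf (D.GtpXu l ⊓ D.DeltaTemp)).Normal := by
  rw [Subgroup.normal_subgroupOf_iff (inf_le_inf_right D.DeltaTemp Ξ.Huu_le_GtpXu)]
  intro n k hn hk
  obtain ⟨hnH, hnΔ⟩ := Subgroup.mem_inf.mp hn
  obtain ⟨hkX, hkΔ⟩ := Subgroup.mem_inf.mp hk
  have hnX : n ∈ D.GtpXu l := Ξ.Huu_le_GtpXu hnH
  refine Subgroup.mem_inf.mpr ⟨?_, ?_⟩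
  · -- the `Π^tp_X̲̲`-part, through the zero set `Huu0 ⊆ Π^tp_X̲`
    have h0 : (⟨n, hnX⟩ : ↥(D.GtpXu l)) ∈ Ξ.Huu0 := (Ξ.mem_Huu_iff hnX).mp hnH
    have hmem := Ξ.conj_mem_Huu0_of_mem_deltaTemp (k := ⟨k, hkX⟩) (n := ⟨n, hnX⟩) hkΔ hnΔ h0
    have hkey : k * n * k⁻¹ ∈ D.GtpXu l := (D.GtpXu l).mul_mem ((D.GtpXu l).mul_mem hkX hnX) ((D.GtpXu l).inv_mem hkX)
    exact (Ξ.mem_Huu_iff hkey).mpr hmem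
  · -- the geometric part: `Δ^tp_X` is normal
    haveI : D.DeltaTemp.Normal := by change D.aug.toMonoidHom.ker.Normal; infer_instance
    exact Subgroup.Normal.conj_mem ‹_› n hnΔ k

/-- The same for the assembled choice `Ξ.doubleUnderline : E.DoubleUnderline l` of abc-iut-L2-t7 (its `Huu` IS `Ξ.Huu`): at this model
of `X̲̲`, `Δ^tp_{X̲̲_v} ⊴ Δ^tp_{X̲_v}`.  PROVED. ([IUTchII] Def 2.3 (i), kurims p.67) [claim: Mochizuki2012, status: disputed] -/
theorem doubleUnderline_huu_inf_deltaTemp_subgroupOf_normal :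
    ((Ξ.doubleUnderline.Huu ⊓ D.DeltaTemp).subgroupOf (D.GtpXu l ⊓ D.DeltaTemp)).Normal :=
  Ξ.huu_inf_deltaTemp_subgroupOf_normal

end XuuCocycleData

end EtaleThetaData

end ThetaSetting

end Literature.AnabelianGeometry.EtaleTheta

end
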